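import Summits.ValiantsHypothesis.ValiantsHypothesis.Theorems.VPBoundarySquareDegree
import Literature.Computability.AlgebraicComplexity.VP0EmptyGateConstants
import Mathlib.Combinatorics.Colex
import HarnessLib

/-!
# VPBoundarySquare — the TOWER FAMILY: an explicit family outside `\overline{VP}^ℂ` whose coefficient
field has ONE generator (decomp-valiant lens 3, NODE v9, theorem T4, sequel of `VPBoundarySquareDegree`)

`not_isVPBarFamily_towerFamily`: for every transcendental `t ∈ ℂ` the multilinear family
`g_n(t) = Σ_{S ⊆ [n]} t^{2^{bin S}} x^S` (`2^n` monomials, coefficients the iterated squares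
`t, t², t⁴, …` of one number) has superpolynomial BORDER complexity. Its coefficient field is `ℚ(t)`
(transcendence degree `1`), so the transcendence-degree / few-constants consequences of U_CH
(`VPBoundarySquareTrdeg`, `VPBoundarySquareFewConstants`) are blind to it; the DEGREE METHOD for the
closure (`degreeMethod_of_approxComplexity_le`) is not: the `2^{2^n}` square-free power products of the
coefficients are distinct powers of `t` (binary expansion twice: `binCode_injective`, `ppExp_injective`),
hence `ℚ`-linearly independent (`linearIndependent_pow_of_transcendental`), and the resulting bound
`2^{2^n} ≤ 2^{B(n)}` with `B` p-bounded fails for large `n` (the landed `IsPBounded.exists_lt_two_pow_self`).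
Border analogue of BCS Cor. (9.4) (`Σ_ν √p_ν X^ν` has exact complexity `≥ √(n / log n)`).

Honest scope: the tower family is not in `VNP^ℂ` either (its coefficients have superpolynomial degree in
`t`), so this says nothing about `VP ≠ VNP`; it certifies that the degree-format consequence of U_CH
(item 24721) is a genuine, unconditional restriction on `\overline{VP}^ℂ` beyond constant counting.
0 sorry. Sources: Bürgisser–Clausen–Shokrollahi 1997, Thm. (9.3), Cor. (9.4) [corpus chunks p0246–p0247];
Bürgisser–Landsberg–Manivel–Weyman 2011, Def. 9.3.1 (approximate complexity).
-/

noncomputable section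

set_option linter.dupNamespace false

open MvPolynomial
open Literature.Computability.AlgebraicComplexity

namespace Summit.ValiantsHypothesis.ValiantsHypothesis.Theorems.VPBoundarySquareTowerFamily

open Summit.ValiantsHypothesis.ValiantsHypothesis.Theorems.VPBoundarySquareTrdeg
open Summit.ValiantsHypothesis.ValiantsHypothesis.Theorems.VPBoundarySquareDegree

/-! ### Growth lemmas -/

/-- `paramCount (v n) (r n)` is p-bounded when `v` and `r` are. [folklore] -/
theorem isPBounded_paramCount {v r : ℕ → ℕ} (hv : IsPBounded v) (hr : IsPBounded r) :
    IsPBounded fun n => paramCount (v n) (r n) := by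
  have hN : IsPBounded fun n => v n + 2 * r n + 1 :=
    IsPBounded.add_holds (IsPBounded.add_holds hv (IsPBounded.mul_holds (IsPBounded.const 2) hr))
      (IsPBounded.const 1)
  have hN1 : IsPBounded fun n => v n + 2 * r n + 1 + 1 := IsPBounded.add_holds hN (IsPBounded.const 1)
  have h2N : IsPBounded fun n => 2 * (v n + 2 * r n + 1) + 1 :=
    IsPBounded.add_holds (IsPBounded.mul_holds (IsPBounded.const 2) hN) (IsPBounded.const 1)
  exact IsPBounded.mul_holds
    (IsPBounded.add_holds hN1 (IsPBounded.mul_holds (IsPBounded.mul_holds hN1 h2N) (IsPBounded.const 2)))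
    (IsPBounded.add_holds hv (IsPBounded.const 1))

/-- The multilinear exponent vector `x^S` of a set `S` of variables. [folklore] -/
def expVec {n : ℕ} (S : Finset (Fin n)) : Fin n →₀ ℕ :=
  Finsupp.equivFunOnFinite.symm fun i => if i ∈ S then 1 else 0

/-- The binary code `Σ_{i ∈ S} 2^i` of a set `S ⊆ {0, …, n-1}`. [folklore] -/
def binCode {n : ℕ} (S : Finset (Fin n)) : ℕ := ∑ i ∈ S, 2 ^ (i : ℕ)

/-- **The tower family** `g_n(t) := Σ_{S ⊆ [n]} t^{2^{bin S}} · x^S` — multilinear, `2^n` monomials,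
coefficients the iterated squares `t, t², t⁴, …, t^{2^{2^n - 1}}` of ONE number `t`.
[cite: BurgisserClausenShokrollahi1997, Cor. (9.4) (§9.1)] -/
def towerFamily (t : ℂ) (n : ℕ) : MvPolynomial (Fin n) ℂ :=
  ∑ S : Finset (Fin n), monomial (expVec S) (t ^ 2 ^ binCode S)

/-- `S ↦ x^S` is injective. [folklore] -/
theorem expVec_injective (n : ℕ) : Function.Injective (expVec (n := n)) := by
  intro S T h
  ext i
  have := congrArg (fun e : Fin n →₀ ℕ => e i) h
  simp only [expVec, Finsupp.coe_equivFunOnFinite_symm] at this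
  by_cases hS : i ∈ S <;> by_cases hT : i ∈ T <;> simp_all

/-- `S ↦ bin S` is injective (uniqueness of binary expansions). [folklore] -/
theorem binCode_injective (n : ℕ) : Function.Injective (binCode (n := n)) := by
  intro S T h
  have hS : binCode S = ∑ k ∈ S.map Fin.valEmbedding, 2 ^ k := by rw [Finset.sum_map]; rfl
  have hT : binCode T = ∑ k ∈ T.map Fin.valEmbedding, 2 ^ k := by rw [Finset.sum_map]; rfl
  rw [hS, hT] at h
  exact (Finset.map_inj).mp (Finset.geomSum_injective le_rfl h)

/-- The coefficient of `x^S` in `g_n(t)` is `t^{2^{bin S}}`. [folklore] -/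
theorem coeff_towerFamily (t : ℂ) {n : ℕ} (S : Finset (Fin n)) :
    coeff (expVec S) (towerFamily t n) = t ^ 2 ^ binCode S := by
  classical
  rw [towerFamily, coeff_sum, Finset.sum_eq_single S]
  · rw [coeff_monomial, if_pos rfl]
  · intro T _ hT
    rw [coeff_monomial, if_neg (fun h => hT (expVec_injective n h))]
  · intro h; exact absurd (Finset.mem_univ S) h

/-- The exponent of a power product of the coefficients. [folklore] -/
def ppExp {n : ℕ} (j : Finset (Fin n) → Fin 2) : ℕ := ∑ S, 2 ^ binCode S * (j S : ℕ)

/-- Power products of the coefficients of `g_n(t)` with exponents `< 2` are powers of `t`. [folklore] -/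
theorem powerProduct_towerFamily (t : ℂ) {n : ℕ} (j : Finset (Fin n) → Fin 2) :
    ∏ S, coeff (expVec S) (towerFamily t n) ^ ((j S : ℕ)) = t ^ ppExp j := by
  simp_rw [coeff_towerFamily, ← pow_mul]
  rw [Finset.prod_pow_eq_pow_sum]
  rfl

/-- Distinct exponent patterns give distinct exponents (binary expansion again). [folklore] -/
theorem ppExp_injective (n : ℕ) : Function.Injective (ppExp (n := n)) := by
  classical
  let emb : Finset (Fin n) ↪ ℕ := ⟨binCode, binCode_injective n⟩
  have key : ∀ j : Finset (Fin n) → Fin 2,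
      ppExp j = ∑ k ∈ (Finset.univ.filter fun S => j S = 1).map emb, 2 ^ k := by
    intro j
    rw [Finset.sum_map, ppExp, Finset.sum_filter]
    refine Finset.sum_congr rfl fun S _ => ?_
    have h2 : (j S : ℕ) < 2 := (j S).2
    by_cases h : j S = 1
    · rw [if_pos h, h]; simp [emb]
    · have h0 : (j S : ℕ) = 0 := by
        have : (j S : ℕ) ≠ 1 := fun h1 => h (Fin.ext h1)
        omega
      rw [if_neg h, h0, mul_zero]
  intro j j' h
  rw [key, key] at h
  have hset := (Finset.map_inj).mp (Finset.geomSum_injective le_rfl h)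
  funext S
  have hS := congrArg (fun U : Finset (Finset (Fin n)) => S ∈ U) hset
  simp only [Finset.mem_filter, Finset.mem_univ, true_and, eq_iff_iff] at hS
  have h2 : (j S : ℕ) < 2 := (j S).2
  have h2' : (j' S : ℕ) < 2 := (j' S).2
  apply Fin.ext
  by_cases h1 : j S = 1
  · rw [h1, hS.mp h1]
  · have h1' : ¬ j' S = 1 := fun h' => h1 (hS.mpr h')
    have a : (j S : ℕ) ≠ 1 := fun e => h1 (Fin.ext e)
    have b : (j' S : ℕ) ≠ 1 := fun e => h1' (Fin.ext e)
    omega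

/-- **Powers of a transcendental number at distinct exponents are linearly independent over `ℚ`.**
[folklore] -/
theorem linearIndependent_pow_of_transcendental {t : ℂ} (ht : Transcendental ℚ t) {ι : Type} [Fintype ι]
    (ψ : ι → ℕ) (hψ : Function.Injective ψ) : LinearIndependent ℚ fun j => t ^ ψ j := by
  classical
  rw [Fintype.linearIndependent_iff]
  intro a ha j₀
  have hinj := transcendental_iff_injective.mp ht
  let p : Polynomial ℚ := ∑ j, Polynomial.monomial (ψ j) (a j)
  have hp : Polynomial.aeval t p = 0 := by
    simp only [p, map_sum, Polynomial.aeval_monomial, ← Algebra.smul_def]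
    exact ha
  have hp0 : p = 0 := hinj (by rw [hp, map_zero])
  have hc : p.coeff (ψ j₀) = a j₀ := by
    simp only [p, Polynomial.finsetSum_coeff, Polynomial.coeff_monomial]
    rw [Finset.sum_eq_single j₀]
    · rw [if_pos rfl]
    · intro j _ hj; rw [if_neg (fun h => hj (hψ h))]
    · intro h; exact absurd (Finset.mem_univ j₀) h
  rw [← hc, hp0, Polynomial.coeff_zero]

/-- The power products of the coefficients of `g_n(t)` with exponents `< 2` are linearly independent
over `ℚ` when `t` is transcendental. [cite: BurgisserClausenShokrollahi1997, Cor. (9.4) (§9.1)] -/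
theorem linearIndependent_powerProducts_towerFamily {t : ℂ} (ht : Transcendental ℚ t) (n : ℕ) :
    LinearIndependent ℚ fun j : Finset (Fin n) → Fin 2 =>
      ∏ S, coeff (expVec S) (towerFamily t n) ^ ((j S : ℕ)) := by
  simp_rw [powerProduct_towerFamily]
  exact linearIndependent_pow_of_transcendental ht ppExp (ppExp_injective n)

/-- **An explicit family outside `\overline{VP}^ℂ`**: for every transcendental `t ∈ ℂ` the tower
family `g_n(t) = Σ_{S ⊆ [n]} t^{2^{bin S}} x^S` has superpolynomial BORDER complexity — although
all its coefficients lie in `ℚ(t)`, a field with ONE generator (so the transcendence-degree method of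
`VPBoundarySquareTrdeg` is blind to it). Border analogue of BCS Cor. (9.4)
(`Σ √p_ν X^ν`): the degree method applied to the `2^{2^n}` square-free power products of the
coefficients. Honest scope: `g(t)` is not in `VNP^ℂ` either; this is the classical high-degree-
coefficients phenomenon, not a step towards `VP ≠ VNP`.
[cite: BurgisserClausenShokrollahi1997, Thm. (9.3), Cor. (9.4) (§9.1)] [cite: BurgisserEtAl2011, Def. 9.3.1] -/
theorem not_isVPBarFamily_towerFamily {t : ℂ} (ht : Transcendental ℚ t) :
    ¬ IsVPBarFamily (towerFamily t) := by
  classical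
  intro hbar
  set r : ℕ → ℕ := fun n => approxComplexity (towerFamily t n) with hr
  have hrb : IsPBounded r := hbar
  -- the exponent bound `B(n)`
  let a : ℕ → ℕ := fun n => 2 * ((n + 2 * r n + 1) * (8 * (n + 2 * r n + 1) + 1))
  let B : ℕ → ℕ := fun n => (a n + n + 1) * paramCount n (r n)
  have hB : IsPBounded B := by
    have hN : IsPBounded fun n => n + 2 * r n + 1 :=
      IsPBounded.add_holds (IsPBounded.add_holds IsPBounded.id (IsPBounded.mul_holds (IsPBounded.const 2) hrb))
        (IsPBounded.const 1)
    have ha : IsPBounded a := IsPBounded.mul_holds (IsPBounded.const 2) (IsPBounded.mul_holds hN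
      (IsPBounded.add_holds (IsPBounded.mul_holds (IsPBounded.const 8) hN) (IsPBounded.const 1)))
    exact IsPBounded.mul_holds (IsPBounded.add_holds (IsPBounded.add_holds ha IsPBounded.id) (IsPBounded.const 1))
      (isPBounded_paramCount IsPBounded.id hrb)
  -- the degree method at every `n`: `2^{2^n} ≤ 2^{B n}`
  have key : ∀ n, 2 ^ n ≤ B n := by
    intro n
    have h := degreeMethod_of_approxComplexity_le (towerFamily t n) (le_refl (r n)) expVec (fun _ => 2)
      (linearIndependent_powerProducts_towerFamily ht n)
    simp only [Finset.prod_const, Finset.sum_const, Finset.card_univ, Fintype.card_finset,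
      Fintype.card_fin, smul_eq_mul, Nat.add_one_sub_one, mul_one] at h
    -- h : 2 ^ 2 ^ n ≤ (2 ^ a n * 2 ^ n + 1) ^ paramCount n (r n)
    have h2 : (2 ^ (a n) * 2 ^ n + 1) ^ paramCount n (r n) ≤ 2 ^ B n := by
      have : 2 ^ (a n) * 2 ^ n + 1 ≤ 2 ^ (a n + n + 1) := by
        rw [← pow_add, pow_succ]; have := Nat.one_le_two_pow (n := a n + n); omega
      calc (2 ^ (a n) * 2 ^ n + 1) ^ paramCount n (r n) ≤ (2 ^ (a n + n + 1)) ^ paramCount n (r n) :=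
            Nat.pow_le_pow_left this _
        _ = 2 ^ B n := by rw [← pow_mul]
    exact (Nat.pow_le_pow_iff_right (by norm_num)).mp (h.trans h2)
  obtain ⟨n, hn⟩ := hB.exists_lt_two_pow_self
  exact absurd (key n) (not_le.mpr hn)

end Summit.ValiantsHypothesis.ValiantsHypothesis.Theorems.VPBoundarySquareTowerFamily

end
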